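import Literature.NumberTheory.GaloisRepresentations.UnitsRelationLattice
import Literature.NumberTheory.GaloisRepresentations.LocalUnitNorms
import HarnessLib

/-!
# The Herbrand quotient of the global units (Childress Prop. 5.10) and the idelic first inequality

Topic `NumberTheory/GaloisRepresentations` (class field theory: Childress, *Class Field Theory*,
Ch. 4 §5 Prop. 5.10 and Thm. 5.11–5.12, PDF pp. 100–103); namespace
`Literature.NumberTheory.GaloisRepresentations.MinkowskiUnit` / `IdeleHerbrand`.
Everything **proved**; this file discharges the last hypothesis (`hunits`) of the idelic norm index
computation.

* **`MinkowskiUnit.card_mul_h0_unitsE_eq`** — Childress Prop. 5.10 in index form for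
  `Gal(E/F) = ⟨σ⟩` cyclic of order `n`: `n · #Ĥ⁰(G, 𝒪_Eˣ) = 2^a · #Ĥ⁻¹(G, 𝒪_Eˣ)` with
  `#Ĥ⁻¹(G, 𝒪_Eˣ) ≠ 0`, where `2^a = ArchHerbrand.archFactor F E`.  Proof: for a Minkowski family
  `u` (`MinkowskiUnits.lean`) realise the permutation lattice `ℤ[S_∞(E)]` in `𝒪_Eˣ`
  (`real u`); its relation lattice `K` is infinite cyclic with trivial action
  (`h⁰ = n`, `h¹ = 1`), the permutation lattice has `h⁰ = 2^a`, `h¹ = 1`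
  (`PermutationLattice.lean`), so the hexagon for `1 ≤ K ≤ ℤ[S_∞]` gives
  `2^a · h¹(ℤ[S_∞]/K) = n · h⁰(ℤ[S_∞]/K)`; transport along `real u` identifies
  `hⁱ(ℤ[S_∞]/K)` with `hⁱ(⟨u_w⟩μ/μ)`; the hexagon for `1 ≤ μ ≤ ⟨u_w⟩μ` (`μ` finite) and the
  finite index `[𝒪_Eˣ : ⟨u_w⟩μ]` (`UnitsRelationLattice.lean`, Cor. 4.4) finish.
* **`IdeleHerbrand.card_mul_h0_globalUnits_eq`** — the same inside `J_E`
  (`unitIdeles E ⊓ principalIdeles E` is the image of `𝒪_Eˣ` under the principal idele map).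
* **`IdeleHerbrand.card_dvd_index_normGroup_of_isCyclic`** — **the idelic global cyclic norm
  index inequality with no hypotheses**: for a cyclic extension `E/F` of number fields,
  `[E : F] ∣ [J_F : Fˣ · N_{E/F} J_E]` and this index is finite (non-zero); in particular
  `[J_F : Fˣ N_{E/F} J_E] ≥ [E : F]` (Childress Thm. 5.11–5.12 in idelic form).

## References

* N. Childress, *Class Field Theory*, Universitext, Springer 2009, Ch. 4 §5 Prop. 5.10,
  Thm. 5.11–5.12 (PDF pp. 100–103). [Childress2009]
* J. W. S. Cassels, A. Fröhlich (eds.), *Algebraic Number Theory* (1967), Ch. VII (Tate) §8.3–§8.4,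
  §9. [CasselsFrohlichANT1967]
-/

noncomputable section

open NumberField NumberField.InfinitePlace

namespace Literature.NumberTheory.GaloisRepresentations

namespace MinkowskiUnit

open PermLattice PermLattice.PermMod Literature.NumberTheory.Automorphic

universe u

variable {F : Type u} [Field F] [NumberField F] {E : Type u} [Field E] [NumberField E] [Algebra F E]

omit [NumberField F] [NumberField E] in
/-- Orbit representatives: every infinite place of `E` is conjugate to the chosen place above its
restriction. [folklore] -/
theorem exists_mem_orbit_placeOver [FiniteDimensional F E] [IsGalois F E] (w : InfinitePlace E) :
    ∃ v : InfinitePlace F, w ∈ MulAction.orbit (E ≃ₐ[F] E) (ArchHerbrand.placeOver E v) := by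
  obtain ⟨g, hg⟩ := ArchHerbrand.exists_smul_eq_of_isOver (ArchHerbrand.isOver_placeOver _)
    (rfl : ArchHerbrand.IsOver E (w.comap (algebraMap F E)) w)
  exact ⟨_, g, hg⟩

omit [NumberField F] [NumberField E] in
/-- Orbit representatives: distinct places of `F` give non-conjugate chosen places. [folklore] -/
theorem eq_of_placeOver_mem_orbit [Algebra.IsAlgebraic F E] (v v' : InfinitePlace F)
    (h : ArchHerbrand.placeOver E v' ∈ MulAction.orbit (E ≃ₐ[F] E) (ArchHerbrand.placeOver E v)) : v = v' := by
  obtain ⟨g, hg⟩ := h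
  have h1 : ArchHerbrand.IsOver E v (ArchHerbrand.placeOver E v') := by
    rw [← hg]; exact (ArchHerbrand.isOver_smul_iff g).mpr (ArchHerbrand.isOver_placeOver v)
  have h2 : ArchHerbrand.IsOver E v' (ArchHerbrand.placeOver E v') := ArchHerbrand.isOver_placeOver v'
  exact h1.symm.trans h2

/-- The image of a stable subgroup under an equivariant homomorphism is stable. [folklore] -/
theorem isStable_map_of_equivariant {G M M' : Type*} [Group G] [CommGroup M] [CommGroup M']
    [MulDistribMulAction G M] [MulDistribMulAction G M'] (φ : M →* M')
    (hφ : ∀ (g : G) (y : M), φ (g • y) = g • φ y) {A : Subgroup M} (hA : Herbrand.IsStable G A) :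
    Herbrand.IsStable G (A.map φ) := by
  rintro g _ ⟨a, ha, rfl⟩
  exact ⟨g • a, hA g ha, hφ g a⟩

/-- **Childress Prop. 5.10 (index form, in `Eˣ`).**  For `E/F` Galois with cyclic group `⟨σ⟩` of
order `n` acting on the global units `𝒪_Eˣ ≤ Eˣ`:
`n · #Ĥ⁰(G, 𝒪_Eˣ) = 2^a · #Ĥ⁻¹(G, 𝒪_Eˣ)` and `#Ĥ⁻¹(G, 𝒪_Eˣ) ≠ 0` (`2^a = archFactor F E`).
[cite: Childress2009, Ch. 4 §5 Prop. 5.10 (PDF pp. 100–101)] -/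
theorem card_mul_h0_unitsE_eq [FiniteDimensional F E] [IsGalois F E] {σ : E ≃ₐ[F] E}
    (hσ : ∀ τ : E ≃ₐ[F] E, τ ∈ Subgroup.zpowers σ) :
    Fintype.card (E ≃ₐ[F] E) * Herbrand.h0 σ (unitsE E) ⊥ =
      ArchHerbrand.archFactor F E * Herbrand.h1 σ (unitsE E) ⊥ ∧ Herbrand.h1 σ (unitsE E) ⊥ ≠ 0 := by
  classical
  set n := Fintype.card (E ≃ₐ[F] E) with hn
  -- a Minkowski family and its realisation
  obtain ⟨u, hu₁, hu₂, hu₃⟩ := exists_family (F := F) (E := E)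
  set φ : PermMod (InfinitePlace E) →* Eˣ := real u with hφdef
  have hφeq : ∀ (g : E ≃ₐ[F] E) (f : PermMod (InfinitePlace E)), φ (g • f) = g • φ f := real_smul hu₂
  set K := relLattice u with hKdef
  set T := torsionE E with hTdef
  set R := (⊤ : Subgroup (PermMod (InfinitePlace E))).map φ with hRdef
  set U' := R ⊔ T with hU'def
  set U := unitsE E with hUdef
  -- stability
  have hKs : Herbrand.IsStable (E ≃ₐ[F] E) K := isStable_relLattice hu₂
  have hTs : Herbrand.IsStable (E ≃ₐ[F] E) T := isStable_torsionE
  have hRs : Herbrand.IsStable (E ≃ₐ[F] E) R := isStable_map_of_equivariant φ hφeq Herbrand.IsStable.top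
  have hU's : Herbrand.IsStable (E ≃ₐ[F] E) U' := hRs.sup hTs
  have hUs : Herbrand.IsStable (E ≃ₐ[F] E) U := isStable_unitsE
  have hRange : R = φ.range := (MonoidHom.range_eq_map φ).symm
  have hRU : R ≤ U := by rw [hRange]; rintro _ ⟨f, rfl⟩; exact real_mem_unitsE hu₁ f
  have hU'U : U' ≤ U := sup_le hRU torsionE_le_unitsE
  -- the permutation lattice and the relation lattice
  have hK0 : K ≠ ⊥ := relLattice_ne_bot hu₁
  have hPh0 : Herbrand.h0 σ (⊤ : Subgroup (PermMod (InfinitePlace E))) ⊥ = ArchHerbrand.archFactor F E :=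
    h0_top_eq_prod (ArchHerbrand.placeOver E) hσ exists_mem_orbit_placeOver eq_of_placeOver_mem_orbit
  have hPh1 : Herbrand.h1 σ (⊤ : Subgroup (PermMod (InfinitePlace E))) ⊥ = 1 :=
    h1_top_eq_one (ArchHerbrand.placeOver E) hσ exists_mem_orbit_placeOver eq_of_placeOver_mem_orbit
  have hKh0 : Herbrand.h0 σ K ⊥ = n := h0_relLattice_eq_card hu₁ hu₃ hu₂ hK0 σ
  have hKh1 : Herbrand.h1 σ K ⊥ = 1 := h1_relLattice_eq_one hu₁ hu₃ hu₂ σ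
  have hA0 : ArchHerbrand.archFactor F E ≠ 0 := ArchHerbrand.archFactor_ne_zero
  have hn0 : n ≠ 0 := Fintype.card_ne_zero
  -- hexagon for `⊥ ≤ K ≤ ⊤` in the permutation lattice
  have hex₁ := Herbrand.hexagon (σ := σ) Herbrand.IsStable.top hKs Herbrand.IsStable.bot bot_le le_top
  rw [hPh0, hPh1, hKh0, hKh1, mul_one, mul_one] at hex₁
  -- `hⁱ(⊤, K) ≠ 0`
  have hq1 : Herbrand.h1 σ (⊤ : Subgroup (PermMod (InfinitePlace E))) K ≠ 0 := fun h0 => by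
    have hd := Herbrand.h1_quot_dvd_mul (σ := σ) Herbrand.IsStable.top hKs Herbrand.IsStable.bot bot_le le_top
    rw [h0, zero_dvd_iff, hKh0, hPh1, mul_one] at hd
    exact hn0 hd
  have hq0 : Herbrand.h0 σ (⊤ : Subgroup (PermMod (InfinitePlace E))) K ≠ 0 := fun h0 => by
    have hd := Herbrand.h0_quot_dvd_mul (σ := σ) Herbrand.IsStable.top hKs Herbrand.IsStable.bot bot_le le_top
    rw [h0, zero_dvd_iff, hKh1, hPh0, one_mul] at hd
    exact hA0 hd
  -- transport along `φ`: `hⁱ(⊤, K) = hⁱ(R, R ⊓ T) = hⁱ(U', T)`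
  have hkerK : (⊤ : Subgroup (PermMod (InfinitePlace E))) ⊓ φ.ker ≤ K := by
    rintro f ⟨-, hf⟩
    rw [hKdef, relLattice, Subgroup.mem_comap, show real u f = 1 from hf]
    exact Subgroup.one_mem _
  have hKmap : K.map φ = R ⊓ T := by
    rw [hKdef, relLattice, Subgroup.map_comap_eq, hRange, inf_comm]
  have ht0 : Herbrand.h0 σ (⊤ : Subgroup (PermMod (InfinitePlace E))) K = Herbrand.h0 σ U' T := by
    rw [← Herbrand.h0_map_eq (σ := σ) φ hφeq Herbrand.IsStable.top hKs le_top hkerK, hKmap, ← hRdef,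
      hU'def, Herbrand.h0_sup_eq hRs hTs]
  have ht1 : Herbrand.h1 σ (⊤ : Subgroup (PermMod (InfinitePlace E))) K = Herbrand.h1 σ U' T := by
    rw [← Herbrand.h1_map_eq (σ := σ) φ hφeq Herbrand.IsStable.top hKs le_top hkerK, hKmap, ← hRdef,
      hU'def, Herbrand.h1_sup_eq hRs hTs]
  rw [ht0, ht1] at hex₁
  rw [ht1] at hq1
  rw [ht0] at hq0
  -- `T` is finite: `h0(T) = h1(T) ≠ 0`
  have hTfin : (⊥ : Subgroup Eˣ).relIndex T ≠ 0 := by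
    rw [Subgroup.relIndex_bot_left]; exact Nat.card_pos.ne'
  obtain ⟨hT01, hT0⟩ := Herbrand.h0_eq_h1_of_relIndex_ne_zero (σ := σ) hTs Herbrand.IsStable.bot bot_le hTfin
  -- hexagon for `⊥ ≤ T ≤ U'`
  have hex₂ := Herbrand.hexagon (σ := σ) hU's hTs Herbrand.IsStable.bot bot_le le_sup_right
  rw [← hT01] at hex₂
  -- `h1(U') ≠ 0`, `h0(U') ≠ 0`
  have hU'1 : Herbrand.h1 σ U' ⊥ ≠ 0 := fun h0 => by
    have hd := Herbrand.h1_dvd_mul (σ := σ) hU's hTs Herbrand.IsStable.bot bot_le le_sup_right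
    rw [h0, zero_dvd_iff, ← hT01] at hd
    exact (mul_ne_zero hq1 hT0) hd
  -- `n · h0(U') = archFactor · h1(U')`
  have hU'eq : n * Herbrand.h0 σ U' ⊥ = ArchHerbrand.archFactor F E * Herbrand.h1 σ U' ⊥ := by
    -- from hex₂: h0(U') h0(T) h1(U',T) = h0(T) h0(U',T) h1(U'), cancel h0(T)
    have e2 : Herbrand.h0 σ U' ⊥ * Herbrand.h1 σ U' T = Herbrand.h0 σ U' T * Herbrand.h1 σ U' ⊥ := by
      have := hex₂
      have h' : Herbrand.h0 σ T ⊥ * (Herbrand.h0 σ U' ⊥ * Herbrand.h1 σ U' T) =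
          Herbrand.h0 σ T ⊥ * (Herbrand.h0 σ U' T * Herbrand.h1 σ U' ⊥) := by
        calc Herbrand.h0 σ T ⊥ * (Herbrand.h0 σ U' ⊥ * Herbrand.h1 σ U' T)
            = Herbrand.h0 σ U' ⊥ * Herbrand.h0 σ T ⊥ * Herbrand.h1 σ U' T := by ring
          _ = Herbrand.h0 σ T ⊥ * Herbrand.h0 σ U' T * Herbrand.h1 σ U' ⊥ := this
          _ = Herbrand.h0 σ T ⊥ * (Herbrand.h0 σ U' T * Herbrand.h1 σ U' ⊥) := by ring
      exact Nat.eq_of_mul_eq_mul_left (Nat.pos_of_ne_zero hT0) h'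
    -- combine with hex₁: archFactor h1(U',T) = n h0(U',T)
    have h' : Herbrand.h1 σ U' T * (n * Herbrand.h0 σ U' ⊥) =
        Herbrand.h1 σ U' T * (ArchHerbrand.archFactor F E * Herbrand.h1 σ U' ⊥) := by
      calc Herbrand.h1 σ U' T * (n * Herbrand.h0 σ U' ⊥)
          = n * (Herbrand.h0 σ U' ⊥ * Herbrand.h1 σ U' T) := by ring
        _ = n * (Herbrand.h0 σ U' T * Herbrand.h1 σ U' ⊥) := by rw [e2]
        _ = (n * Herbrand.h0 σ U' T) * Herbrand.h1 σ U' ⊥ := by ring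
        _ = (ArchHerbrand.archFactor F E * Herbrand.h1 σ U' T) * Herbrand.h1 σ U' ⊥ := by rw [hex₁]
        _ = Herbrand.h1 σ U' T * (ArchHerbrand.archFactor F E * Herbrand.h1 σ U' ⊥) := by ring
    exact Nat.eq_of_mul_eq_mul_left (Nat.pos_of_ne_zero hq1) h'
  -- finite index `[U : U']`: Cor. 4.4
  have hfin : U'.relIndex U ≠ 0 := by
    rw [hU'def, hRange, hφdef]
    exact relIndex_realRange_sup_torsionE_ne_zero hu₁ hu₃
  have hcor := Herbrand.h0_mul_h1_eq_of_relIndex_ne_zero (σ := σ) hUs hU's Herbrand.IsStable.bot bot_le hU'U hfin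
  have hU1 : Herbrand.h1 σ U ⊥ ≠ 0 :=
    (Herbrand.h1_ne_zero_iff_of_relIndex_ne_zero (σ := σ) hUs hU's Herbrand.IsStable.bot bot_le hU'U hfin).mpr hU'1
  refine ⟨?_, hU1⟩
  have h' : Herbrand.h1 σ U' ⊥ * (n * Herbrand.h0 σ U ⊥) =
      Herbrand.h1 σ U' ⊥ * (ArchHerbrand.archFactor F E * Herbrand.h1 σ U ⊥) := by
    calc Herbrand.h1 σ U' ⊥ * (n * Herbrand.h0 σ U ⊥)
        = n * (Herbrand.h0 σ U ⊥ * Herbrand.h1 σ U' ⊥) := by ring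
      _ = n * (Herbrand.h0 σ U' ⊥ * Herbrand.h1 σ U ⊥) := by rw [hcor]
      _ = (n * Herbrand.h0 σ U' ⊥) * Herbrand.h1 σ U ⊥ := by ring
      _ = (ArchHerbrand.archFactor F E * Herbrand.h1 σ U' ⊥) * Herbrand.h1 σ U ⊥ := by rw [hU'eq]
      _ = Herbrand.h1 σ U' ⊥ * (ArchHerbrand.archFactor F E * Herbrand.h1 σ U ⊥) := by ring
  exact Nat.eq_of_mul_eq_mul_left (Nat.pos_of_ne_zero hU'1) h'

end MinkowskiUnit

/-! ### Transport to the idele group and the final idelic inequality -/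

namespace IdeleHerbrand

open Literature.NumberTheory.Automorphic IsDedekindDomain MinkowskiUnit

universe u

variable {F : Type u} [Field F] [NumberField F] {E : Type u} [Field E] [NumberField E] [Algebra F E]

/-- A global unit has valuation `1` at every finite place. [folklore] -/
theorem valuation_coe_unit_eq_one (x : (𝓞 E)ˣ) (w : HeightOneSpectrum (𝓞 E)) :
    w.valuation E ((x : 𝓞 E) : E) = 1 := by
  apply le_antisymm (HeightOneSpectrum.valuation_le_one w (x : 𝓞 E))
  have h : w.valuation E ((x : 𝓞 E) : E) * w.valuation E (((x⁻¹ : (𝓞 E)ˣ) : 𝓞 E) : E) = 1 := by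
    have : ((x : 𝓞 E) : E) * (((x⁻¹ : (𝓞 E)ˣ) : 𝓞 E) : E) = 1 := by
      rw [RingOfIntegers.coe_eq_algebraMap, RingOfIntegers.coe_eq_algebraMap, ← map_mul, ← Units.val_mul,
        mul_inv_cancel, Units.val_one, map_one]
    rw [← map_mul, this, map_one]
  calc (1 : WithZero (Multiplicative ℤ)) = _ := h.symm
    _ ≤ w.valuation E ((x : 𝓞 E) : E) * 1 :=
        mul_le_mul_right (HeightOneSpectrum.valuation_le_one w _) _
    _ = w.valuation E ((x : 𝓞 E) : E) := mul_one _

omit [NumberField F] in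
/-- **The global units inside `J_E`**: `𝓔_E ∩ Eˣ` is the image of `𝒪_Eˣ` under the principal
idele map. [cite: Childress2009, Ch. 4 §5 proof of Thm. 5.11 (PDF p. 102)] -/
theorem map_principal_unitsE :
    (unitsE E).map (principal E) = unitIdeles E ⊓ principalIdeles E := by
  apply le_antisymm
  · rintro _ ⟨a, ⟨x, rfl⟩, rfl⟩
    refine ⟨fun w => ?_, ⟨_, rfl⟩⟩
    show Valued.v ((algebraMap E (AdeleRing (𝓞 E) E) ((x : 𝓞 E) : E)).2 w) = 1
    rw [AdeleRing.algebraMap_snd, FiniteAdeleRing.algebraMap_apply,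
      HeightOneSpectrum.valuedAdicCompletion_eq_valuation']
    exact valuation_coe_unit_eq_one x w
  · rintro y ⟨hyu, k, rfl⟩
    -- `k` and `k⁻¹` are integral at every finite place
    have hval : ∀ w : HeightOneSpectrum (𝓞 E), w.valuation E (k : E) = 1 := fun w => by
      have := hyu w
      rw [show ((Units.map (algebraMap E (AdeleRing (𝓞 E) E) : E →* AdeleRing (𝓞 E) E) k : ideleGroup E) :
          AdeleRing (𝓞 E) E).2 w = algebraMap E (FiniteAdeleRing (𝓞 E) E) (k : E) w from rfl,
        FiniteAdeleRing.algebraMap_apply, HeightOneSpectrum.valuedAdicCompletion_eq_valuation'] at this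
      exact this
    obtain ⟨a, ha⟩ := HeightOneSpectrum.mem_integers_of_valuation_le_one (R := 𝓞 E) (K := E) (k : E) fun w => (hval w).le
    obtain ⟨b, hb⟩ := HeightOneSpectrum.mem_integers_of_valuation_le_one (R := 𝓞 E) (K := E) ((k⁻¹ : Eˣ) : E) fun w => by
      rw [Units.val_inv_eq_inv_val, map_inv₀, hval w, inv_one]
    have hab : a * b = 1 := by
      apply RingOfIntegers.coe_injective
      show ((a * b : 𝓞 E) : E) = ((1 : 𝓞 E) : E)
      rw [RingOfIntegers.coe_eq_algebraMap, RingOfIntegers.coe_eq_algebraMap, map_mul, ha, hb, map_one,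
        Units.val_inv_eq_inv_val, mul_inv_cancel₀ k.ne_zero]
    set x : (𝓞 E)ˣ := ⟨a, b, hab, by rw [mul_comm, hab]⟩
    refine ⟨Units.map (algebraMap (𝓞 E) E : 𝓞 E →* E) x, ⟨x, rfl⟩, ?_⟩
    apply Units.ext
    show algebraMap E (AdeleRing (𝓞 E) E) (algebraMap (𝓞 E) E a) = algebraMap E (AdeleRing (𝓞 E) E) (k : E)
    rw [ha]

variable [IsGalois F E] [FiniteDimensional F E]

/-- **Childress Prop. 5.10 inside `J_E`**: for `Gal(E/F) = ⟨σ⟩` cyclic of order `n`,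
`n · #Ĥ⁰(G, 𝓔_E ∩ Eˣ) = 2^a · #Ĥ⁻¹(G, 𝓔_E ∩ Eˣ) ≠ 0`.
[cite: Childress2009, Ch. 4 §5 Prop. 5.10 (PDF pp. 100–101)] -/
theorem card_mul_h0_globalUnits_eq {σ : E ≃ₐ[F] E} (hσ : ∀ τ : E ≃ₐ[F] E, τ ∈ Subgroup.zpowers σ) :
    Fintype.card (E ≃ₐ[F] E) * Herbrand.h0 σ (unitIdeles E ⊓ principalIdeles E) ⊥ =
      ArchHerbrand.archFactor F E * Herbrand.h1 σ (unitIdeles E ⊓ principalIdeles E) ⊥ ∧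
    Herbrand.h1 σ (unitIdeles E ⊓ principalIdeles E) ⊥ ≠ 0 := by
  have hker : unitsE E ⊓ (principal E).ker ≤ ⊥ := by
    rintro a ⟨-, ha⟩
    rw [Subgroup.mem_bot]
    exact principal_injective (by rw [show principal E a = 1 from ha, map_one])
  have h0 := Herbrand.h0_map_eq (σ := σ) (principal E) (fun g y => principal_smul g y) isStable_unitsE
    Herbrand.IsStable.bot bot_le hker
  have h1 := Herbrand.h1_map_eq (σ := σ) (principal E) (fun g y => principal_smul g y) isStable_unitsE
    Herbrand.IsStable.bot bot_le hker
  rw [map_principal_unitsE, Subgroup.map_bot] at h0 h1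
  rw [h0, h1]
  exact card_mul_h0_unitsE_eq hσ

/-- **The global cyclic norm index inequality, idelic form (Childress Thm. 5.11 ⇒ 5.12; no
hypotheses).**  For a cyclic extension `E/F` of number fields with Galois group `⟨σ⟩` of order
`n = [E : F]`, the norm group `Fˣ · N_{E/F} J_E ≤ J_F` has finite index divisible by `n`; in
particular `[J_F : Fˣ N_{E/F} J_E] ≥ [E : F]`.
[cite: Childress2009, Ch. 4 §5 Thm. 5.11–5.12 (PDF pp. 101–103); CasselsFrohlichANT1967, Ch. VII §9] -/
theorem card_dvd_index_normGroup_of_isCyclic {σ : E ≃ₐ[F] E}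
    (hσ : ∀ τ : E ≃ₐ[F] E, τ ∈ Subgroup.zpowers σ) :
    Fintype.card (E ≃ₐ[F] E) ∣ (normGroup F E).index ∧ (normGroup F E).index ≠ 0 := by
  obtain ⟨hunits, hunits'⟩ := card_mul_h0_globalUnits_eq (F := F) (E := E) hσ
  exact card_dvd_index_normGroup' hσ hunits hunits'

/-- **First inequality for cyclic extensions (idelic form).**  `[E : F] ≤ [J_F : Fˣ N_{E/F} J_E]`
for `E/F` cyclic. [cite: Childress2009, Ch. 4 §5 Thm. 5.12 (PDF p. 103)] -/
theorem finrank_le_index_normGroup_of_isCyclic (h : IsCyclic (E ≃ₐ[F] E)) :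
    Module.finrank F E ≤ (normGroup F E).index := by
  obtain ⟨σ, hσ⟩ := h.exists_generator
  obtain ⟨hdvd, hne⟩ := card_dvd_index_normGroup_of_isCyclic (F := F) (E := E) hσ
  rw [← IsGalois.card_aut_eq_finrank, Nat.card_eq_fintype_card]
  exact Nat.le_of_dvd (Nat.pos_of_ne_zero hne) hdvd

end IdeleHerbrand

end Literature.NumberTheory.GaloisRepresentations
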